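import Summits.HubbardSuperconductivity.HubbardSuperconductivity.Theorems.AnisotropyChordTransferFibre3AssemblyHole2
import Summits.HubbardSuperconductivity.HubbardSuperconductivity.Theorems.AnisotropyChordTransferFibre3Hole2FinRange

/-!
# Route `AnisotropyChord` / H0 rotor rung: the GM₃ assembly on the FIN range WITHOUT the HOLE₂ hypothesis

Consumer corollary of the per-`L` kernel certificates (`…Fibre3Hole2FinRange.twoHoleGap_finRange`): in p1's assembly `gm3_of_hole2`
(`…Fibre3AssemblyHole2`, g23) the one-body spectral hypothesis `TwoHoleGap L (3/4·eps1 L)` is now DISCHARGED for every `9 ≤ L ≤ 32`,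
so on the FIN range GM₃ follows from the three β-free cruxes with constants `(c, a, b)` and — for every ground profile — `mHole ≥ 0` plus
the arithmetic side condition, nothing else (`gm3_finRange`).  (`L = 8` is not covered: HOLE₂(.75) is false there, p1's
`not_twoHoleGap_eight`; `L ≥ 33` is the analytic regime of the theory seat's plan.)
Prover seat `hubbard-h0-rotor-p3` g3; helper for stmt-HubbardSuperconductivity-19089 (`--supports`, helper class).
WHAT THIS IS NOT: nothing here proves superconductivity in the Hubbard model (rotor TARGET as worded stays FALSE, g15 verdict); it
removes ONE hypothesis of ONE conditional reduction (rung 19089) on a finite range of `L`; the cruxes `TrialGapAbs`/`LowShellGFormAbs`/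
`OffPoleTailAbs`, `mHole ≥ 0` and the side condition remain hypotheses. Tree imports only; no sorry, no axioms.
-/

set_option linter.dupNamespace false
set_option autoImplicit false

namespace Summit.HubbardSuperconductivity.HubbardSuperconductivity.Theorems.AnisotropyChord.Transfer.Fibre3

/-- ★ **GM₃ on the FIN range `9 ≤ L ≤ 32` from the three β-free cruxes alone** (plus `mHole ≥ 0` and the side condition for the ground
profile): `gm3_of_hole2` with its HOLE₂(.75) hypothesis discharged by the kernel certificates `Hole2.twoHoleGap_finRange`. [folklore] -/
theorem gm3_finRange (L : ℕ) [NeZero L] (h9 : 9 ≤ L) (h32 : L ≤ 32) {Δ : ℝ} (hΔ0 : 0 < Δ) (hΔ1 : Δ < 1) (c a b : ℝ)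
    (hreg : ∀ lam2 : ℝ, ∀ f : Tor L → ℝ, IsGroundTwoMagnon L Δ lam2 f →
      0 ≤ mHole L Δ f ∧ facMI L Δ f * etaEff L lam2 * (a + b / (2 + Real.cos (2 * Real.pi / L))) < c)
    (hKT1 : TrialGapAbs L Δ c) (hKT2a : LowShellGFormAbs L Δ a) (hKT2b : OffPoleTailAbs L Δ b) : GM3Fibre L Δ :=
  gm3_of_hole2 L (by omega) hΔ0 hΔ1 c a b (Hole2.twoHoleGap_finRange L h9 h32) hreg hKT1 hKT2a hKT2b

end Summit.HubbardSuperconductivity.HubbardSuperconductivity.Theorems.AnisotropyChord.Transfer.Fibre3
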